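import Summits.NavierStokesRegularity.NavierStokesRegularity.Theorems.EpisodeBaseT.Negative.MirrorOddPusherNoAnchor
import Summits.NavierStokesRegularity.NavierStokesRegularity.Theorems.EpisodeBaseT.Negative.MirrorPairAtMostOneAnchors
import Summits.NavierStokesRegularity.FluidComputer.PalasekTowerGermHostDipoleCone
import HarnessLib

/-!
# The two-sided ring family `μ₁ • P_δ + μ₂ • P♭_δ`: anchor number `= (μ₁² − μ₂²) · I(δ)`, so every anchoring member lies in
# ONE pair of cones `|μ₁| ≷ |μ₂|` (Negative lane, `EpisodeBaseT`, line «doormirror», stub D2a)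

Cell `ns-blowup`, seat `ns-blowup-refuter4` (g12; D-0074 GROUP C «BRIDGE SUPPORT», Negative lane (α)). Sixth file of the
mirror series (p567521, p569185, p572223, p572865, p578128).

§1 makes the anchor integrand `x ↦ D³Γ(0 − x)(P x, P x, c e₃)` of p567521 an honest `L¹` object: off the origin it IS the
closed form of `fderiv3_newtonKernel_apply` (`anchorIntegrand_eq_div`), it vanishes wherever the device does, and for a
continuous compactly supported device vanishing on a ball around `0` it is CONTINUOUS and INTEGRABLE
(`continuous_anchorIntegrand`, `integrable_anchorIntegrand`).

§2 THE TWO-SIDED LAW. For a device `A` whose support is disjoint from that of its mirror image `A♭ = M ∘ A ∘ M`: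
`∫ anchorIntegrand (μ₁ • A + μ₂ • A♭) c = (μ₁² − μ₂²) · ∫ anchorIntegrand A c` (`integral_anchorIntegrand_twoSided`:
pointwise the quadratic form splits over the disjoint supports, p578128 `anchorIntegrand_smul`; the mirror half contributes
MINUS the same number, p567521). For fc-prover-2's ring pusher (supported in `9/2 ≤ x₂ ≤ 11/2`) and its mirror
(`−11/2 ≤ x₂ ≤ −9/2`) the supports are disjoint (`ringPusher_or_mirrorRingPusher_eq_zero`), so
`integral_anchorIntegrand_ringFamily`.

§3 CONSEQUENCES at an even admissible core and on the blob of record (`tinyProfileAt R a`, `0 < a ≤ 2`):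
* `strictAnchor_ringFamily_iff` — the strict anchor of `U₁ + (μ₁ • P_δ + μ₂ • P♭_δ)` at `0` reads
  `−ν⟪U₁ 0, ΔU₁ 0⟫ < (μ₁² − μ₂²) · I(δ)`, `I(δ) = ∫ anchorIntegrand (ringPusher δ) c`;
* `sq_ne_sq_of_strictAnchor_ringFamily` — an anchoring member has `μ₁² ≠ μ₂²` (both diagonals are sterile: p572223, p578128);
* `sameSide_of_strictAnchor_ringFamily` — TWO anchoring members `(μ₁, μ₂)`, `(μ₁', μ₂')` satisfy
  `0 < (μ₁² − μ₂²)(μ₁'² − μ₂'²)`: ALL anchoring members lie in the same pair of opposite cones, WITHOUT computing the sign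
  of `I(δ)`; on the blob of record `levelZeroDataAt_ringFamily_sameSide`.
With any ONE positive member known (fc-prover-2's `levelZeroDataAt_sterileCarrierAt`, `μ₂ = 0`), the anchoring cone at that
thinness is `|μ₁| > |μ₂|`: the ring ABOVE must out-weigh its mirror BELOW, whatever the signs.

LABEL: kernel analysis (theorems only). WHAT THIS IS NOT: not Navier–Stokes evidence; not a refutation of D2a (existential,
and a theorem by name since p569312) or of any route item; no flow, stage, schedule or certificate; sorry-free, std axioms.
bears_on: LADDER-NS N1 (route-NavierStokesRegularity-PalasekTowerBreakdown), item 20303, stub D2a.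

References: A. J. Majda, A. L. Bertozzi (CUP 2002) §1.8 Prop. 1.16 [cite: MajdaBertozziCUP2002, §1.8 Prop. 1.16];
D. Gilbarg, N. S. Trudinger (Springer 2001) (2.13) for `D³Γ`.
-/

noncomputable section

open Literature.Analysis.FluidPDE
open Summit.NavierStokesRegularity.FluidComputer.PalasekTowerClayBridge
open Summit.NavierStokesRegularity.FluidComputer.PalasekTowerClayBridge.TinyBlob
open Summit.NavierStokesRegularity.FluidComputer.PalasekTowerClayBridge.Germ
open Summit.NavierStokesRegularity.EpisodeBaseTRingPusherMirrorAnchorSign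
open Summit.NavierStokesRegularity.EpisodeBaseTMirrorInvariantPusherNoAnchor
open Summit.NavierStokesRegularity.EpisodeBaseTMirrorPairAtMostOneAnchors
open Summit.NavierStokesRegularity.EpisodeBaseTMirrorOddPusherNoAnchor
open MeasureTheory InnerProductSpace Metric Set Filter Real
open scoped RealInnerProductSpace ContDiff Laplacian Topology

-- nested operator types `ℝ³ →L[ℝ] ℝ³ →L[ℝ] ℝ`
set_option maxSynthPendingDepth 3

namespace Summit.NavierStokesRegularity.EpisodeBaseTTwoSidedRingFamilyAnchorLaw

/-! ## §1 The anchor integrand as an honest function: closed form, vanishing, continuity, integrability -/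

/-- The anchor integrand sees the device only through its value at the point. [folklore] -/
theorem anchorIntegrand_congr {P Q : EuclideanSpace ℝ (Fin 3) → EuclideanSpace ℝ (Fin 3)} {x : EuclideanSpace ℝ (Fin 3)}
    (h : P x = Q x) (c : ℝ) : anchorIntegrand P c x = anchorIntegrand Q c x := by
  unfold anchorIntegrand
  rw [h]

/-- Where the device vanishes, so does the anchor integrand. [folklore] -/
theorem anchorIntegrand_eq_zero_of_apply_eq_zero {P : EuclideanSpace ℝ (Fin 3) → EuclideanSpace ℝ (Fin 3)}
    {x : EuclideanSpace ℝ (Fin 3)} (h : P x = 0) (c : ℝ) : anchorIntegrand P c x = 0 := by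
  have hc : P x = ((0 : ℝ) • P) x := by rw [Pi.smul_apply, zero_smul, h]
  rw [anchorIntegrand_congr hc, anchorIntegrand_smul]
  ring

/-- **Closed form off the origin** (`fderiv3_newtonKernel_apply`): for `x ≠ 0`, with `z = 0 − x`, `d = P x`, `e = c e₃`,
`anchorIntegrand P c x = (15⟨z,d⟩²⟨z,e⟩ − 3|z|²(|d|²⟨z,e⟩ + 2⟨d,e⟩⟨z,d⟩)) / (4π|z|⁷)`. [cite: GilbargTrudinger2001, (2.13)] -/
theorem anchorIntegrand_eq_div (P : EuclideanSpace ℝ (Fin 3) → EuclideanSpace ℝ (Fin 3)) (c : ℝ)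
    {x : EuclideanSpace ℝ (Fin 3)} (hx : x ≠ 0) :
    anchorIntegrand P c x =
      (15 * ⟪(0 : EuclideanSpace ℝ (Fin 3)) - x, P x⟫ * ⟪(0 : EuclideanSpace ℝ (Fin 3)) - x, P x⟫ *
            ⟪(0 : EuclideanSpace ℝ (Fin 3)) - x, c • e₃⟫ -
          3 * ‖(0 : EuclideanSpace ℝ (Fin 3)) - x‖ ^ 2 *
            (⟪P x, P x⟫ * ⟪(0 : EuclideanSpace ℝ (Fin 3)) - x, c • e₃⟫ +
              ⟪P x, c • e₃⟫ * ⟪(0 : EuclideanSpace ℝ (Fin 3)) - x, P x⟫ +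
              ⟪P x, c • e₃⟫ * ⟪(0 : EuclideanSpace ℝ (Fin 3)) - x, P x⟫)) /
        (4 * π * ‖(0 : EuclideanSpace ℝ (Fin 3)) - x‖ ^ 7) := by
  have hz : (0 : EuclideanSpace ℝ (Fin 3)) - x ≠ 0 := by rw [zero_sub, neg_ne_zero]; exact hx
  unfold anchorIntegrand
  rw [fderiv3_newtonKernel_apply hz]

/-- Continuity off the origin (through the closed form: a quotient of continuous functions with non-vanishing
denominator). [folklore] -/
theorem continuousAt_anchorIntegrand_of_ne {P : EuclideanSpace ℝ (Fin 3) → EuclideanSpace ℝ (Fin 3)} (hP : Continuous P)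
    (c : ℝ) {x : EuclideanSpace ℝ (Fin 3)} (hx : x ≠ 0) : ContinuousAt (anchorIntegrand P c) x := by
  have h0 : Continuous fun y : EuclideanSpace ℝ (Fin 3) => (0 : EuclideanSpace ℝ (Fin 3)) - y :=
    continuous_const.sub continuous_id
  have h1 : Continuous fun y => ⟪(0 : EuclideanSpace ℝ (Fin 3)) - y, P y⟫ := h0.inner hP
  have h2 : Continuous fun y => ⟪(0 : EuclideanSpace ℝ (Fin 3)) - y, c • e₃⟫ := h0.inner continuous_const
  have h3 : Continuous fun y => ⟪P y, P y⟫ := hP.inner hP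
  have h4 : Continuous fun y => ⟪P y, c • e₃⟫ := hP.inner continuous_const
  have h5 : Continuous fun y => ‖(0 : EuclideanSpace ℝ (Fin 3)) - y‖ := h0.norm
  have hN : Continuous fun y =>
      15 * ⟪(0 : EuclideanSpace ℝ (Fin 3)) - y, P y⟫ * ⟪(0 : EuclideanSpace ℝ (Fin 3)) - y, P y⟫ *
          ⟪(0 : EuclideanSpace ℝ (Fin 3)) - y, c • e₃⟫ -
        3 * ‖(0 : EuclideanSpace ℝ (Fin 3)) - y‖ ^ 2 *
          (⟪P y, P y⟫ * ⟪(0 : EuclideanSpace ℝ (Fin 3)) - y, c • e₃⟫ +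
            ⟪P y, c • e₃⟫ * ⟪(0 : EuclideanSpace ℝ (Fin 3)) - y, P y⟫ +
            ⟪P y, c • e₃⟫ * ⟪(0 : EuclideanSpace ℝ (Fin 3)) - y, P y⟫) :=
    (((continuous_const.mul h1).mul h1).mul h2).sub
      ((continuous_const.mul (h5.pow 2)).mul (((h3.mul h2).add (h4.mul h1)).add (h4.mul h1)))
  have hD : Continuous fun y => 4 * π * ‖(0 : EuclideanSpace ℝ (Fin 3)) - y‖ ^ 7 := continuous_const.mul (h5.pow 7)
  have hn : 0 < ‖(0 : EuclideanSpace ℝ (Fin 3)) - x‖ := by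
    rw [zero_sub, norm_neg]
    exact norm_pos_iff.2 hx
  have hDx : 4 * π * ‖(0 : EuclideanSpace ℝ (Fin 3)) - x‖ ^ 7 ≠ 0 := by positivity
  have hopen : IsOpen {y : EuclideanSpace ℝ (Fin 3) | y ≠ 0} := isOpen_ne
  exact ((hN.continuousAt.div hD.continuousAt hDx).congr
    (eventuallyEq_of_mem (hopen.mem_nhds hx) fun y hy => (anchorIntegrand_eq_div P c hy).symm))

/-- Continuity at the origin for a device vanishing on a ball around it. [folklore] -/
theorem continuousAt_anchorIntegrand_zero {P : EuclideanSpace ℝ (Fin 3) → EuclideanSpace ℝ (Fin 3)} (c : ℝ) {r : ℝ}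
    (hr : 0 < r) (hzero : ∀ y, ‖y‖ < r → P y = 0) : ContinuousAt (anchorIntegrand P c) 0 := by
  have heq : (fun _ => (0 : ℝ)) =ᶠ[𝓝 (0 : EuclideanSpace ℝ (Fin 3))] anchorIntegrand P c :=
    eventuallyEq_of_mem (ball_mem_nhds _ hr) fun y hy =>
      (anchorIntegrand_eq_zero_of_apply_eq_zero (hzero y (mem_ball_zero_iff.1 hy)) c).symm
  exact continuousAt_const.congr heq

/-- **Continuity**: for a continuous device vanishing on a ball around the origin, the anchor integrand is continuous.
[folklore] -/
theorem continuous_anchorIntegrand {P : EuclideanSpace ℝ (Fin 3) → EuclideanSpace ℝ (Fin 3)} (hP : Continuous P) (c : ℝ)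
    {r : ℝ} (hr : 0 < r) (hzero : ∀ y, ‖y‖ < r → P y = 0) : Continuous (anchorIntegrand P c) :=
  continuous_iff_continuousAt.2 fun x => by
    by_cases hx : x = 0
    · subst hx
      exact continuousAt_anchorIntegrand_zero c hr hzero
    · exact continuousAt_anchorIntegrand_of_ne hP c hx

/-- The anchor integrand is supported inside the device's support. [folklore] -/
theorem hasCompactSupport_anchorIntegrand {P : EuclideanSpace ℝ (Fin 3) → EuclideanSpace ℝ (Fin 3)}
    (hPc : HasCompactSupport P) (c : ℝ) : HasCompactSupport (anchorIntegrand P c) :=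
  HasCompactSupport.intro hPc fun _ hx => anchorIntegrand_eq_zero_of_apply_eq_zero (image_eq_zero_of_notMem_tsupport hx) c

/-- **Integrability**: for a continuous compactly supported device vanishing on a ball around the origin, the anchor
integrand is integrable. [folklore] -/
theorem integrable_anchorIntegrand {P : EuclideanSpace ℝ (Fin 3) → EuclideanSpace ℝ (Fin 3)} (hP : Continuous P)
    (hPc : HasCompactSupport P) (c : ℝ) {r : ℝ} (hr : 0 < r) (hzero : ∀ y, ‖y‖ < r → P y = 0) :
    Integrable (anchorIntegrand P c) :=
  (continuous_anchorIntegrand hP c hr hzero).integrable_of_hasCompactSupport (hasCompactSupport_anchorIntegrand hPc c)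

/-! ## §2 The two-sided law -/

/-- Pointwise splitting over disjoint supports: `anchorIntegrand (μ₁ • A + μ₂ • B) c x = μ₁² aI A + μ₂² aI B` whenever at
every point one of `A`, `B` vanishes. [folklore] -/
theorem anchorIntegrand_twoSided_apply {A B : EuclideanSpace ℝ (Fin 3) → EuclideanSpace ℝ (Fin 3)}
    (hdisj : ∀ x, A x = 0 ∨ B x = 0) (μ₁ μ₂ c : ℝ) (x : EuclideanSpace ℝ (Fin 3)) :
    anchorIntegrand (μ₁ • A + μ₂ • B) c x = μ₁ ^ 2 * anchorIntegrand A c x + μ₂ ^ 2 * anchorIntegrand B c x := by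
  rcases hdisj x with h | h
  · have hc : (μ₁ • A + μ₂ • B) x = (μ₂ • B) x := by simp [h]
    rw [anchorIntegrand_congr hc, anchorIntegrand_smul, anchorIntegrand_eq_zero_of_apply_eq_zero h]
    ring
  · have hc : (μ₁ • A + μ₂ • B) x = (μ₁ • A) x := by simp [h]
    rw [anchorIntegrand_congr hc, anchorIntegrand_smul, anchorIntegrand_eq_zero_of_apply_eq_zero h]
    ring

/-- **THE TWO-SIDED LAW.** `A` continuous, compactly supported, vanishing on a ball `‖y‖ < r` (`r > 0`), with support
disjoint from that of its mirror image `A♭ y = M (A (M y))`. Then for all `μ₁ μ₂ c`: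
`∫ anchorIntegrand (μ₁ • A + μ₂ • A♭) c = (μ₁² − μ₂²) · ∫ anchorIntegrand A c`. [cite: MajdaBertozziCUP2002, §1.8 Prop. 1.16] -/
theorem integral_anchorIntegrand_twoSided {A : EuclideanSpace ℝ (Fin 3) → EuclideanSpace ℝ (Fin 3)} (hA : Continuous A)
    (hAc : HasCompactSupport A) {r : ℝ} (hr : 0 < r) (hzero : ∀ y, ‖y‖ < r → A y = 0)
    (hdisj : ∀ x, A x = 0 ∨ mirrorZ (A (mirrorZ x)) = 0) (μ₁ μ₂ c : ℝ) :
    ∫ x, anchorIntegrand (μ₁ • A + μ₂ • fun y => mirrorZ (A (mirrorZ y))) c x =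
      (μ₁ ^ 2 - μ₂ ^ 2) * ∫ x, anchorIntegrand A c x := by
  have hA0 : A 0 = 0 := hzero 0 (by rw [norm_zero]; exact hr)
  have hzero' : ∀ y, ‖y‖ < r → mirrorZ (A (mirrorZ y)) = 0 := fun y hy => by
    rw [hzero (mirrorZ y) (by rwa [mirrorZ.norm_map]), map_zero]
  have hf := integrable_anchorIntegrand hA hAc c hr hzero
  have hg : Integrable (anchorIntegrand (fun y => mirrorZ (A (mirrorZ y))) c) :=
    integrable_anchorIntegrand (P := fun y => mirrorZ (A (mirrorZ y)))
      (mirrorZ.continuous.comp (hA.comp mirrorZ.continuous)) (hasCompactSupport_mirrorConj hAc) c hr hzero'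
  have hsplit : (fun x => anchorIntegrand (μ₁ • A + μ₂ • fun y => mirrorZ (A (mirrorZ y))) c x) =
      fun x => μ₁ ^ 2 * anchorIntegrand A c x + μ₂ ^ 2 * anchorIntegrand (fun y => mirrorZ (A (mirrorZ y))) c x :=
    funext fun x => anchorIntegrand_twoSided_apply hdisj μ₁ μ₂ c x
  rw [hsplit, integral_add (hf.const_mul _) (hg.const_mul _), integral_const_mul, integral_const_mul,
    integral_anchorIntegrand_mirror A hA0 c]
  ring

/-- The ring pusher (`9/2 ≤ x₂ ≤ 11/2` on its support) and its mirror image (`−11/2 ≤ x₂ ≤ −9/2`) have disjoint supports: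
at every point one of them vanishes. [folklore] -/
theorem ringPusher_or_mirrorRingPusher_eq_zero {δ : ℝ} (hδ : 0 < δ) (hδ4 : δ ≤ 1 / 4) (x : EuclideanSpace ℝ (Fin 3)) :
    ringPusher δ x = 0 ∨ mirrorRingPusher δ x = 0 := by
  by_cases hx : (9 / 2 : ℝ) ≤ x 2
  · right
    have hM : mirrorZ x ∉ ringRegion := fun ⟨_, h1, _⟩ => by
      rw [mirrorZ_apply_two] at h1
      linarith
    rw [mirrorRingPusher, ringPusher_eq_zero_of_notMem hδ hδ4 hM, map_zero]
  · left
    exact ringPusher_eq_zero_of_notMem hδ hδ4 fun ⟨_, h1, _⟩ => hx h1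

/-- **The two-sided ring family**: `∫ anchorIntegrand (μ₁ • P_δ + μ₂ • P♭_δ) c = (μ₁² − μ₂²) · ∫ anchorIntegrand P_δ c`
(`0 < δ ≤ 1/4`). [cite: MajdaBertozziCUP2002, §1.8 Prop. 1.16] -/
theorem integral_anchorIntegrand_ringFamily {δ : ℝ} (hδ : 0 < δ) (hδ4 : δ ≤ 1 / 4) (μ₁ μ₂ c : ℝ) :
    ∫ x, anchorIntegrand (μ₁ • ringPusher δ + μ₂ • mirrorRingPusher δ) c x =
      (μ₁ ^ 2 - μ₂ ^ 2) * ∫ x, anchorIntegrand (ringPusher δ) c x := by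
  have hmir : mirrorRingPusher δ = fun y => mirrorZ (ringPusher δ (mirrorZ y)) := rfl
  rw [hmir]
  exact integral_anchorIntegrand_twoSided (continuous_ringPusher δ) (hasCompactSupport_ringPusher hδ hδ4)
    (by norm_num : (0 : ℝ) < 9 / 2) (fun y hy => ringPusher_eq_zero_of_norm_lt hδ hδ4 hy)
    (ringPusher_or_mirrorRingPusher_eq_zero hδ hδ4) μ₁ μ₂ c

/-! ## §3 Consequences: the anchoring members of the family lie in one pair of cones -/

/-- The two-sided member vanishes on `‖x‖ < 9/2`. [folklore] -/
theorem ringFamily_eq_zero_of_norm_lt {δ : ℝ} (hδ : 0 < δ) (hδ4 : δ ≤ 1 / 4) (μ₁ μ₂ : ℝ)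
    {x : EuclideanSpace ℝ (Fin 3)} (hx : ‖x‖ < 9 / 2) : (μ₁ • ringPusher δ + μ₂ • mirrorRingPusher δ) x = 0 := by
  rw [Pi.add_apply, Pi.smul_apply, Pi.smul_apply, ringPusher_eq_zero_of_norm_lt hδ hδ4 hx,
    mirrorRingPusher_eq_zero_of_norm_lt hδ hδ4 hx, smul_zero, smul_zero, add_zero]

/-- On the support of a two-sided member, `‖x‖ ≥ 9/2`. [folklore] -/
theorem norm_ge_of_mem_tsupport_ringFamily {δ : ℝ} (hδ : 0 < δ) (hδ4 : δ ≤ 1 / 4) (μ₁ μ₂ : ℝ)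
    {x : EuclideanSpace ℝ (Fin 3)} (hx : x ∈ tsupport (μ₁ • ringPusher δ + μ₂ • mirrorRingPusher δ)) :
    (9 / 2 : ℝ) ≤ ‖x‖ := by
  have hcl : IsClosed {y : EuclideanSpace ℝ (Fin 3) | (9 / 2 : ℝ) ≤ ‖y‖} := isClosed_le continuous_const continuous_norm
  refine (closure_minimal (fun y hy => ?_) hcl) hx
  by_contra hlt
  exact hy (ringFamily_eq_zero_of_norm_lt hδ hδ4 μ₁ μ₂ (not_le.1 hlt))

/-- A two-sided member is smooth. [folklore] -/
theorem contDiff_ringFamily (δ μ₁ μ₂ : ℝ) : ContDiff ℝ ∞ (μ₁ • ringPusher δ + μ₂ • mirrorRingPusher δ) :=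
  ((contDiff_ringPusher δ).const_smul μ₁).add ((contDiff_mirrorRingPusher δ).const_smul μ₂)

/-- A two-sided member has compact support (`0 < δ ≤ 1/4`). [folklore] -/
theorem hasCompactSupport_ringFamily {δ : ℝ} (hδ : 0 < δ) (hδ4 : δ ≤ 1 / 4) (μ₁ μ₂ : ℝ) :
    HasCompactSupport (μ₁ • ringPusher δ + μ₂ • mirrorRingPusher δ) :=
  (((hasCompactSupport_ringPusher hδ hδ4).comp_left (g := fun v : EuclideanSpace ℝ (Fin 3) => μ₁ • v) (smul_zero μ₁)).add
    ((hasCompactSupport_mirrorRingPusher hδ hδ4).comp_left (g := fun v : EuclideanSpace ℝ (Fin 3) => μ₂ • v) (smul_zero μ₂)))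

/-- A two-sided member is divergence free. [folklore] -/
theorem isDivFree_ringFamily (δ μ₁ μ₂ : ℝ) : VectorCalculus.IsDivFree (μ₁ • ringPusher δ + μ₂ • mirrorRingPusher δ) := by
  have h1 := VectorCalculus.IsDivFree.const_smul ((contDiff_ringPusher δ).differentiable (by simp)) (isDivFree_ringPusher δ) μ₁
  have h2 := VectorCalculus.IsDivFree.const_smul ((contDiff_mirrorRingPusher δ).differentiable (by simp))
    (isDivFree_mirrorRingPusher δ) μ₂
  intro x
  show VectorCalculus.divergence (fun y => μ₁ • ringPusher δ y + μ₂ • mirrorRingPusher δ y) x = 0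
  rw [divergence_add_apply ((((contDiff_ringPusher δ).const_smul μ₁).differentiable (by simp)) x)
    ((((contDiff_mirrorRingPusher δ).const_smul μ₂).differentiable (by simp)) x), h1 x, h2 x, add_zero]

/-- **THE STRICT ANCHOR OF A TWO-SIDED MEMBER, IN CLOSED TERMS.** `U₁ ∈ C_c^∞` divergence free, even about `0`,
`tsupport U₁ ⊆ B(0, 9/2)`, `U₁ 0 = c e₃`; `0 < δ ≤ 1/4`. Then `U₁ + (μ₁ • P_δ + μ₂ • P♭_δ)` strictly anchors at `0` iff
`−ν⟪U₁ 0, ΔU₁ 0⟫ < (μ₁² − μ₂²) · ∫ anchorIntegrand P_δ c`. [cite: MajdaBertozziCUP2002, §1.8 Prop. 1.16] -/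
theorem strictAnchor_ringFamily_iff {ν : ℝ} {U₁ : EuclideanSpace ℝ (Fin 3) → EuclideanSpace ℝ (Fin 3)}
    (h₁ : ContDiff ℝ ∞ U₁) (h₁c : HasCompactSupport U₁) (hdiv₁ : VectorCalculus.IsDivFree U₁) (he : IsEvenAbout 0 U₁)
    (hsupp : tsupport U₁ ⊆ ball (0 : EuclideanSpace ℝ (Fin 3)) (9 / 2)) {c : ℝ} (hU0 : U₁ 0 = c • e₃)
    {δ : ℝ} (hδ : 0 < δ) (hδ4 : δ ≤ 1 / 4) (μ₁ μ₂ : ℝ) :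
    0 < ⟪(U₁ + (μ₁ • ringPusher δ + μ₂ • mirrorRingPusher δ)) 0,
        accel ν (U₁ + (μ₁ • ringPusher δ + μ₂ • mirrorRingPusher δ)) 0⟫ ↔
      -(ν * ⟪U₁ 0, (Δ U₁) 0⟫) < (μ₁ ^ 2 - μ₂ ^ 2) * ∫ x, anchorIntegrand (ringPusher δ) c x := by
  have hfarP : ∀ x ∈ tsupport (μ₁ • ringPusher δ + μ₂ • mirrorRingPusher δ), (9 / 2 : ℝ) ≤ ‖x‖ := fun x hx =>
    norm_ge_of_mem_tsupport_ringFamily hδ hδ4 μ₁ μ₂ hx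
  have hd : Disjoint (tsupport U₁) (tsupport (μ₁ • ringPusher δ + μ₂ • mirrorRingPusher δ)) :=
    disjoint_left.2 fun x hx₁ hx₂ => (not_le.2 (mem_ball_zero_iff.1 (hsupp hx₁))) (hfarP x hx₂)
  have hfar : ∀ x ∈ tsupport (μ₁ • ringPusher δ + μ₂ • mirrorRingPusher δ),
      (9 / 4 : ℝ) < ‖(0 : EuclideanSpace ℝ (Fin 3)) - x‖ := fun x hx => by
    rw [zero_sub, norm_neg]
    linarith [hfarP x hx]
  rw [anchor_test_iff_fderiv3 (ν := ν) h₁ h₁c hdiv₁ he (contDiff_ringFamily δ μ₁ μ₂) (hasCompactSupport_ringFamily hδ hδ4 μ₁ μ₂)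
    (isDivFree_ringFamily δ μ₁ μ₂) hd (by norm_num : (0 : ℝ) < 9 / 4) hfar, hU0]
  show _ < ∫ x, anchorIntegrand (μ₁ • ringPusher δ + μ₂ • mirrorRingPusher δ) c x ↔ _
  rw [integral_anchorIntegrand_ringFamily hδ hδ4]

/-- **An anchoring member is OFF BOTH DIAGONALS**: `μ₁² ≠ μ₂²` (given `−ν⟪U₁ 0, ΔU₁ 0⟫ ≥ 0`). [cite: MajdaBertozziCUP2002, §1.8 Prop. 1.16] -/
theorem sq_ne_sq_of_strictAnchor_ringFamily {ν : ℝ} {U₁ : EuclideanSpace ℝ (Fin 3) → EuclideanSpace ℝ (Fin 3)}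
    (h₁ : ContDiff ℝ ∞ U₁) (h₁c : HasCompactSupport U₁) (hdiv₁ : VectorCalculus.IsDivFree U₁) (he : IsEvenAbout 0 U₁)
    (hsupp : tsupport U₁ ⊆ ball (0 : EuclideanSpace ℝ (Fin 3)) (9 / 2)) {c : ℝ} (hU0 : U₁ 0 = c • e₃)
    (hΔ : 0 ≤ -(ν * ⟪U₁ 0, (Δ U₁) 0⟫)) {δ : ℝ} (hδ : 0 < δ) (hδ4 : δ ≤ 1 / 4) {μ₁ μ₂ : ℝ}
    (h : 0 < ⟪(U₁ + (μ₁ • ringPusher δ + μ₂ • mirrorRingPusher δ)) 0,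
        accel ν (U₁ + (μ₁ • ringPusher δ + μ₂ • mirrorRingPusher δ)) 0⟫) : μ₁ ^ 2 ≠ μ₂ ^ 2 := fun heq => by
  have h' := (strictAnchor_ringFamily_iff h₁ h₁c hdiv₁ he hsupp hU0 hδ hδ4 μ₁ μ₂).1 h
  rw [heq, sub_self, zero_mul] at h'
  linarith

/-- **ALL ANCHORING MEMBERS LIE IN THE SAME PAIR OF CONES**: if `(μ₁, μ₂)` and `(μ₁', μ₂')` both make `U₁ + member` strictly
anchor at `0` (with `−ν⟪U₁ 0, ΔU₁ 0⟫ ≥ 0`), then `0 < (μ₁² − μ₂²)(μ₁'² − μ₂'²)` — no sign computation of the anchor number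
needed. [cite: MajdaBertozziCUP2002, §1.8 Prop. 1.16] -/
theorem sameSide_of_strictAnchor_ringFamily {ν : ℝ} {U₁ : EuclideanSpace ℝ (Fin 3) → EuclideanSpace ℝ (Fin 3)}
    (h₁ : ContDiff ℝ ∞ U₁) (h₁c : HasCompactSupport U₁) (hdiv₁ : VectorCalculus.IsDivFree U₁) (he : IsEvenAbout 0 U₁)
    (hsupp : tsupport U₁ ⊆ ball (0 : EuclideanSpace ℝ (Fin 3)) (9 / 2)) {c : ℝ} (hU0 : U₁ 0 = c • e₃)
    (hΔ : 0 ≤ -(ν * ⟪U₁ 0, (Δ U₁) 0⟫)) {δ : ℝ} (hδ : 0 < δ) (hδ4 : δ ≤ 1 / 4) {μ₁ μ₂ μ₁' μ₂' : ℝ}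
    (h : 0 < ⟪(U₁ + (μ₁ • ringPusher δ + μ₂ • mirrorRingPusher δ)) 0,
        accel ν (U₁ + (μ₁ • ringPusher δ + μ₂ • mirrorRingPusher δ)) 0⟫)
    (h' : 0 < ⟪(U₁ + (μ₁' • ringPusher δ + μ₂' • mirrorRingPusher δ)) 0,
        accel ν (U₁ + (μ₁' • ringPusher δ + μ₂' • mirrorRingPusher δ)) 0⟫) :
    0 < (μ₁ ^ 2 - μ₂ ^ 2) * (μ₁' ^ 2 - μ₂' ^ 2) := by
  set I := ∫ x, anchorIntegrand (ringPusher δ) c x with hI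
  have k := (strictAnchor_ringFamily_iff h₁ h₁c hdiv₁ he hsupp hU0 hδ hδ4 μ₁ μ₂).1 h
  have k' := (strictAnchor_ringFamily_iff h₁ h₁c hdiv₁ he hsupp hU0 hδ hδ4 μ₁' μ₂').1 h'
  have hp : 0 < (μ₁ ^ 2 - μ₂ ^ 2) * I := by linarith
  have hp' : 0 < (μ₁' ^ 2 - μ₂' ^ 2) * I := by linarith
  by_contra hle
  rw [not_lt] at hle
  nlinarith [mul_pos hp hp', sq_nonneg I, mul_nonpos_iff.2 (Or.inr ⟨hle, sq_nonneg I⟩)]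

/-- **ON THE BLOB OF RECORD: level 0 in the two-sided family reads `0 < (μ₁² − μ₂²) · I(δ)`** (`0 < a ≤ 2`, `0 < δ ≤ 1/4`):
two level-0 members `(μ₁, μ₂)`, `(μ₁', μ₂')` (any radii `ρ ρ'`) satisfy `0 < (μ₁² − μ₂²)(μ₁'² − μ₂'²)`, and a level-0 member
has `μ₁² ≠ μ₂²`. [cite: MajdaBertozziCUP2002, §1.8 Prop. 1.16] -/
theorem levelZeroDataAt_ringFamily_sameSide (R : TowerRates) {a : ℝ} (ha : 0 < a) (ha2 : a ≤ 2) {δ : ℝ} (hδ : 0 < δ)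
    (hδ4 : δ ≤ 1 / 4) {μ₁ μ₂ μ₁' μ₂' : ℝ} {ρ ρ' : ℝ}
    (hL : LevelZeroDataAt R (tinyProfileAt R a + (μ₁ • ringPusher δ + μ₂ • mirrorRingPusher δ)) ρ)
    (hL' : LevelZeroDataAt R (tinyProfileAt R a + (μ₁' • ringPusher δ + μ₂' • mirrorRingPusher δ)) ρ') :
    0 < (μ₁ ^ 2 - μ₂ ^ 2) * (μ₁' ^ 2 - μ₂' ^ 2) := by
  obtain ⟨heven, -, hflat⟩ := tinyProfileAt_even_flat R a
  have hsupp : tsupport (tinyProfileAt R a) ⊆ ball (0 : EuclideanSpace ℝ (Fin 3)) (9 / 2) := fun x hx => by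
    have h := tsupport_tinyProfileAt_subset (R := R) ha hx
    rw [mem_closedBall, dist_zero_right] at h
    rw [mem_ball, dist_zero_right]
    linarith
  have hΔ : 0 ≤ -(1 * ⟪tinyProfileAt R a 0, (Δ (tinyProfileAt R a)) 0⟫) := by
    rw [hflat, inner_zero_right, mul_zero, neg_zero]
  have hat : ∀ μ₁ μ₂ : ℝ, ‖(tinyProfileAt R a + (μ₁ • ringPusher δ + μ₂ • mirrorRingPusher δ)) 0‖ = R.Y 0 := fun μ₁ μ₂ => by
    rw [Pi.add_apply, ringFamily_eq_zero_of_norm_lt hδ hδ4 μ₁ μ₂ (by rw [norm_zero]; norm_num), add_zero]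
    exact (tinyProfileAt_zero R a).2
  exact sameSide_of_strictAnchor_ringFamily (ν := 1) (contDiff_tinyProfileAt R a) (hasCompactSupport_tinyProfileAt ha)
    (isDivFree_tinyProfileAt ha.ne') heven hsupp (tinyProfileAt_zero R a).1 hΔ hδ hδ4 (hL.anchor 0 (hat μ₁ μ₂))
    (hL'.anchor 0 (hat μ₁' μ₂'))

/-- A level-0 member of the two-sided family (blob of record, `0 < a ≤ 2`, `0 < δ ≤ 1/4`) is off both diagonals:
`μ₁² ≠ μ₂²`. [cite: MajdaBertozziCUP2002, §1.8 Prop. 1.16] -/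
theorem sq_ne_sq_of_levelZeroDataAt_ringFamily (R : TowerRates) {a : ℝ} (ha : 0 < a) (ha2 : a ≤ 2) {δ : ℝ} (hδ : 0 < δ)
    (hδ4 : δ ≤ 1 / 4) {μ₁ μ₂ ρ : ℝ}
    (hL : LevelZeroDataAt R (tinyProfileAt R a + (μ₁ • ringPusher δ + μ₂ • mirrorRingPusher δ)) ρ) : μ₁ ^ 2 ≠ μ₂ ^ 2 :=
  fun heq => by
    have h := levelZeroDataAt_ringFamily_sameSide R ha ha2 hδ hδ4 hL hL
    rw [heq, sub_self, zero_mul] at h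
    exact lt_irrefl 0 h

end Summit.NavierStokesRegularity.EpisodeBaseTTwoSidedRingFamilyAnchorLaw

end
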